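import Literature.MathematicalPhysics.QuantumFieldTheory.Balaban1983to89.B4TorusKernel

/-!
# Port piece U8 — THE METHOD OF IMAGES, FILE 1 (generic): TAILS OF A PERIODISATION `Σ_{m∈ℤ^{d+1}} K(x + N·m)` OF AN EXPONENTIALLY DECAYING LATTICE KERNEL —
# `P_N K (x) = K(x) + tail`, `‖tail‖ ≤ M·C(κ,d)·e^{−κt/4}` for periods `N_i ≥ t ≥ 1` and centred `x` (`2|x_i| ≤ N_i`); the TWO-PERIOD comparison
# `‖P_N K (x) − P_{N′} K (x)‖ ≤ 2M·C·e^{−κt/4}`; and the LIMIT EXTRACTION `(∀ t ∃ N ≥ t, ‖P_N K (x)‖ ≤ B) → ‖K(x)‖ ≤ B`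

Cell `ym-nodeO-ideate` ∕ `ym-balaban-port`, porter `ymgap-nodeO-port-PTB-1` (gen 5), PORT-PLAN-v4 §1.  JOIN-side helper for **stmt-QuantumFields-27238** (K0ᴬ),
`--supports … --as helper`.  [B5] = [Balaban1984PropagatorsI] (p. 36 ll. 20–23: «relating G on the torus to G on the whole lattice ηℤ^d in the usual way»); the engine is the
tree's `B4TorusKernel.MultiPeriod` (`translate`, `periodConst`, `norm_translate_le`, `periodise_bound`: the torus kernel of a strip-regular multiplier IS the periodised
lattice kernel, `torusKernel_descend_eq`).  WHY: the whole-torus window response of the (δ) road is such a torus kernel (✓`windowResp_univ_eq_re_HkOp` + [B5] (1.63)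
`B5Hk163Torus.gker_toT_eq_torusKernel`), the lattice kernel being INDEPENDENT of the volume; two volumes `K`, `K+1` of the record differ only in the period vector, so their
responses differ by a difference of TAILS (images `m ≠ 0`) — the two-volume row (R4ᴰ)′ without any window ∕ domain-change estimate (files 2–5).

WHAT IS PROVED (kernel, sorry-free; all `[folklore]` lattice bookkeeping; `d + 1 ≥ 1` coordinates, `K : ℤ^{d+1} → ℂ` with `‖K y‖ ≤ M e^{−κ|y|_∞}`, `κ > 0`).
§1 `supNorm_translate_ge` — for `m ≠ 0`, periods `N_i ≥ t ≥ 1` and centred `x`: `|x + N·m|_∞ ≥ t·|m|_∞∕2`; `norm_translate_le_tail` — the images `m ≠ 0` carry the factor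
   `e^{−κt/4}`: `‖K(x + N·m)‖ ≤ M·e^{−κt/4}·Π_i (e^{−κ/(4(d+1))})^{|m_i|}`.
§2 `exists_tailConst` — `∃ C ≥ 0` (depending on `κ, d`) with: `P_N K (x) = K(x) + T`, `‖T‖ ≤ M·C·e^{−κt/4}` (`periodise_eq_add_tail`, `norm_periodise_sub_self_le`), the
   two-period comparison `norm_periodise_sub_periodise_le`, and the limit extraction `norm_le_of_forall_periodise_le`.
§3 `periodise_re` — real parts commute with periodisation (the responses are real parts of complex torus kernels).

HONEST FRAMING.  Generic lattice∕series bookkeeping (Mathlib + the tree's B4 engine); no Bałaban content; prepares the images road of PORT-PLAN-v4; 27931 CLOSED·IMPLICATION-ONLY·IN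
TOTO unchanged; K0ᴬ 27238 OPEN; NODE O 0∕1; COUNT 8∕28 · K 1∕4 UNMOVED; finite `𝕋⁴_{L^K}` at fixed ε — NOT continuum ∕ OS ∕ Clay; **the Yang–Mills mass gap (Clay) is NOT proved.**
-/

noncomputable section

open scoped BigOperators
open Filter Topology

namespace Summit.QuantumFields.YangMills.Theorems.PortU8.Images

open Literature.MathematicalPhysics.QuantumFieldTheory.Balaban1983to89
open Literature.MathematicalPhysics.QuantumFieldTheory.Balaban1983to89.B4ContourShift (supNorm exists_supNorm_eq abs_le_supNorm supNorm_nonneg)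
open Literature.MathematicalPhysics.QuantumFieldTheory.Balaban1983to89.B4TorusKernel (summable_prod_pi summable_geometric_int exp_supNorm_le_prod)
open Literature.MathematicalPhysics.QuantumFieldTheory.Balaban1983to89.B4TorusKernel.MultiPeriod (translate translate_apply periodise_bound)

variable {d : ℕ}

/-! ## §1  The images `m ≠ 0` are far: `|x + N·m|_∞ ≥ t|m|_∞∕2` -/

/-- For a nonzero image index `m`, periods `N_i ≥ t` and a centred point (`2|x_i| ≤ N_i`): `t·|m|_∞ ≤ 2·|x + N·m|_∞`. [folklore] -/
theorem supNorm_translate_ge {N : Fin (d + 1) → ℕ} {t : ℕ} (ht : ∀ i, t ≤ N i) (x : Fin (d + 1) → ℤ) (hx : ∀ i, 2 * |x i| ≤ N i)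
    (m : Fin (d + 1) → ℤ) : (t : ℝ) * supNorm m ≤ 2 * supNorm (translate N x m) := by
  obtain ⟨i, hi⟩ := exists_supNorm_eq m
  rw [hi]
  by_cases hm : m i = 0
  · rw [hm]; simp only [abs_zero, Int.cast_zero, mul_zero]
    exact mul_nonneg (by norm_num) (supNorm_nonneg _)
  · have h1 : ((|translate N x m i| : ℤ) : ℝ) ≤ supNorm (translate N x m) := abs_le_supNorm _ i
    have hmi : 1 ≤ |m i| := Int.one_le_abs hm
    -- `|x_i + N_i m_i| ≥ N_i|m_i| − |x_i| ≥ N_i|m_i| − N_i/2 ≥ N_i|m_i|/2 ≥ t|m_i|/2`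
    have h2 : (N i : ℤ) * |m i| - |x i| ≤ |x i + N i * m i| := by
      have := abs_sub_abs_le_abs_sub ((N i : ℤ) * m i) (-x i)
      rw [abs_mul, abs_neg, Nat.abs_cast] at this
      have e : (N i : ℤ) * m i - -x i = x i + N i * m i := by ring
      rw [e] at this; linarith
    have h3 : (t : ℤ) * |m i| ≤ 2 * |x i + N i * m i| := by
      have hti : (t : ℤ) ≤ N i := by exact_mod_cast ht i
      have hxi := hx i
      nlinarith
    have h3' : (t : ℝ) * ((|m i| : ℤ) : ℝ) ≤ 2 * ((|translate N x m i| : ℤ) : ℝ) := by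
      rw [translate_apply]; exact_mod_cast h3
    linarith

/-- **THE IMAGES `m ≠ 0` CARRY THE FACTOR `e^{−κt/4}`**: for `‖K y‖ ≤ M e^{−κ|y|_∞}`, periods `N_i ≥ t ≥ 1`, a centred point and `m ≠ 0`,
`‖K(x + N·m)‖ ≤ M·e^{−κt/4}·Π_i (e^{−κ/(4(d+1))})^{|m_i|}`. [folklore] -/
theorem norm_translate_le_tail (K : (Fin (d + 1) → ℤ) → ℂ) {κ M : ℝ} (hκ : 0 ≤ κ) (hK : ∀ y, ‖K y‖ ≤ M * Real.exp (-(κ * supNorm y)))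
    {N : Fin (d + 1) → ℕ} {t : ℕ} (ht1 : 1 ≤ t) (ht : ∀ i, t ≤ N i) (x : Fin (d + 1) → ℤ) (hx : ∀ i, 2 * |x i| ≤ N i)
    {m : Fin (d + 1) → ℤ} (hm : m ≠ 0) :
    ‖K (translate N x m)‖ ≤ M * Real.exp (-(κ * t / 4)) * ∏ i, Real.exp (-(κ / 4 / (d + 1))) ^ (m i).natAbs := by
  have hM : 0 ≤ M := by
    have h := hK 0
    nlinarith [norm_nonneg (K 0), Real.exp_pos (-(κ * supNorm (0 : Fin (d + 1) → ℤ)))]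
  -- `|m|_∞ ≥ 1`
  have hm1 : (1 : ℝ) ≤ supNorm m := by
    obtain ⟨i, hi⟩ : ∃ i, m i ≠ 0 := by
      by_contra h; push Not at h; exact hm (funext h)
    have : ((|m i| : ℤ) : ℝ) ≤ supNorm m := abs_le_supNorm m i
    have h1 : (1 : ℤ) ≤ |m i| := Int.one_le_abs hi
    have h1' : (1 : ℝ) ≤ ((|m i| : ℤ) : ℝ) := by exact_mod_cast h1
    linarith
  have hsup := supNorm_translate_ge ht x hx m
  -- `κ|x + Nm|_∞ ≥ κ t|m|_∞/2 ≥ κt/4 + κ|m|_∞/4`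
  have ht1' : (1 : ℝ) ≤ t := by exact_mod_cast ht1
  have hkey : κ * t / 4 + κ / 4 * supNorm m ≤ κ * supNorm (translate N x m) := by
    have h0 : (t : ℝ) / 4 + supNorm m / 4 ≤ (t : ℝ) * supNorm m / 2 := by nlinarith
    have := mul_le_mul_of_nonneg_left (h0.trans (by linarith : (t : ℝ) * supNorm m / 2 ≤ supNorm (translate N x m))) hκ
    linarith
  calc ‖K (translate N x m)‖ ≤ M * Real.exp (-(κ * supNorm (translate N x m))) := hK _
    _ ≤ M * (Real.exp (-(κ * t / 4)) * Real.exp (-(κ / 4 * supNorm m))) := by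
        refine mul_le_mul_of_nonneg_left ?_ hM
        rw [← Real.exp_add]; exact Real.exp_le_exp.2 (by linarith)
    _ ≤ M * (Real.exp (-(κ * t / 4)) * ∏ i, Real.exp (-(κ / 4 / (d + 1) * |((m i : ℤ) : ℝ)|))) :=
        mul_le_mul_of_nonneg_left (mul_le_mul_of_nonneg_left (exp_supNorm_le_prod (by positivity) m) (Real.exp_pos _).le) hM
    _ = M * Real.exp (-(κ * t / 4)) * ∏ i, Real.exp (-(κ / 4 / (d + 1))) ^ (m i).natAbs := by
        rw [mul_assoc]; congr 2
        refine Finset.prod_congr rfl fun i _ => ?_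
        rw [← Real.exp_nat_mul]; congr 1
        have e3 : ((m i).natAbs : ℝ) = |((m i : ℤ) : ℝ)| := by
          rw [← Int.cast_abs, ← Int.natCast_natAbs]; simp
        rw [e3]; ring

/-! ## §2  `P_N K = K + tail`, the tail bound, the two-period comparison, the limit extraction -/

/-- **THE TAIL CONSTANT** `C(κ, d) = (2∕(1 − e^{−κ/(4(d+1))}))^{d+1}` and the four facts it governs, for every kernel with `‖K y‖ ≤ M e^{−κ|y|_∞}`:
(a) `P_N K (x) := Σ_m K(x + N·m)` converges and `P_N K (x) = K(x) + Σ_{m≠0} K(x + N·m)`; (b) `‖P_N K (x) − K(x)‖ ≤ M·C·e^{−κt/4}` for periods `N_i ≥ t ≥ 1` and centred `x`;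
(c) `‖P_N K (x) − P_{N′} K (x)‖ ≤ 2·M·C·e^{−κt/4}` for two such period vectors; (d) if for every `t` some period vector `N ≥ t + 1`, centring `x`, has `‖P_N K (x)‖ ≤ B`, then `‖K(x)‖ ≤ B`.
[cite: Balaban1984PropagatorsI, p.36 ll.20–23 (the torus-vs-lattice road; ours)] [folklore] -/
theorem exists_tailConst (d : ℕ) {κ : ℝ} (hκ : 0 < κ) :
    ∃ C : ℝ, 0 ≤ C ∧ ∀ (K : (Fin (d + 1) → ℤ) → ℂ) (M : ℝ), (∀ y, ‖K y‖ ≤ M * Real.exp (-(κ * supNorm y))) →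
      ∀ (N : Fin (d + 1) → ℕ) (t : ℕ), 1 ≤ t → (∀ i, t ≤ N i) → ∀ x : Fin (d + 1) → ℤ, (∀ i, 2 * |x i| ≤ N i) →
        Summable (fun m : Fin (d + 1) → ℤ => K (translate N x m)) ∧
        ‖(∑' m : Fin (d + 1) → ℤ, K (translate N x m)) - K x‖ ≤ M * C * Real.exp (-(κ * t / 4)) := by
  set r : ℝ := Real.exp (-(κ / 4 / (d + 1))) with hr
  have hr0 : 0 ≤ r := (Real.exp_pos _).le
  have hr1 : r < 1 := Real.exp_lt_one_iff.mpr (neg_lt_zero.mpr (by positivity))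
  obtain ⟨hgs, hgle⟩ := summable_geometric_int hr0 hr1
  obtain ⟨hps, hpe⟩ := summable_prod_pi (k := d + 1) (fun _ j => r ^ j.natAbs) (fun _ j => pow_nonneg hr0 _) (fun _ => hgs)
  refine ⟨(2 / (1 - r)) ^ (d + 1), by positivity, fun K M hK N t ht1 ht x hx => ?_⟩
  classical
  have hM : 0 ≤ M := by
    have h := hK 0
    nlinarith [norm_nonneg (K 0), Real.exp_pos (-(κ * supNorm (0 : Fin (d + 1) → ℤ)))]
  have hN1 : ∀ i, 1 ≤ N i := fun i => ht1.trans (ht i)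
  have hs : Summable (fun m : Fin (d + 1) → ℤ => K (translate N x m)) := (periodise_bound K hκ hK hN1 x hx).1
  refine ⟨hs, ?_⟩
  have h0 : translate N x 0 = x := by funext i; simp
  rw [hs.tsum_eq_add_tsum_ite 0, h0, add_sub_cancel_left]
  -- the tail, majorised termwise by `M e^{−κt/4} Π_i r^{|m_i|}`
  set A : ℝ := M * Real.exp (-(κ * t / 4)) with hA
  have hA0 : 0 ≤ A := by positivity
  have hle : ∀ m : Fin (d + 1) → ℤ, ‖(if m = 0 then 0 else K (translate N x m))‖ ≤ A * ∏ i, r ^ (m i).natAbs := by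
    intro m
    by_cases hm : m = 0
    · rw [if_pos hm, norm_zero]; exact mul_nonneg hA0 (Finset.prod_nonneg fun i _ => pow_nonneg hr0 _)
    · rw [if_neg hm]; exact norm_translate_le_tail K hκ.le hK ht1 ht x hx hm
  have hmaj : Summable (fun m : Fin (d + 1) → ℤ => A * ∏ i, r ^ (m i).natAbs) := hps.mul_left A
  calc ‖∑' m : Fin (d + 1) → ℤ, (if m = 0 then 0 else K (translate N x m))‖
      ≤ ∑' m : Fin (d + 1) → ℤ, A * ∏ i, r ^ (m i).natAbs := tsum_of_norm_bounded hmaj.hasSum hle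
    _ = A * (∑' j : ℤ, r ^ j.natAbs) ^ (d + 1) := by
        rw [tsum_mul_left, hpe, Finset.prod_const, Finset.card_univ, Fintype.card_fin]
    _ ≤ A * (2 / (1 - r)) ^ (d + 1) := by
        apply mul_le_mul_of_nonneg_left _ hA0
        exact pow_le_pow_left₀ (tsum_nonneg fun j => pow_nonneg hr0 _) hgle _
    _ = M * (2 / (1 - r)) ^ (d + 1) * Real.exp (-(κ * t / 4)) := by rw [hA]; ring

/-- **TWO PERIODS**: for period vectors `N, N′ ≥ t ≥ 1` both centring `x`, the two periodisations differ by at most `2·M·C·e^{−κt/4}`. [folklore] -/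
theorem norm_periodise_sub_periodise_le {κ : ℝ} {C : ℝ}
    (hC : ∀ (K : (Fin (d + 1) → ℤ) → ℂ) (M : ℝ), (∀ y, ‖K y‖ ≤ M * Real.exp (-(κ * supNorm y))) →
      ∀ (N : Fin (d + 1) → ℕ) (t : ℕ), 1 ≤ t → (∀ i, t ≤ N i) → ∀ x : Fin (d + 1) → ℤ, (∀ i, 2 * |x i| ≤ N i) →
        Summable (fun m : Fin (d + 1) → ℤ => K (translate N x m)) ∧
        ‖(∑' m : Fin (d + 1) → ℤ, K (translate N x m)) - K x‖ ≤ M * C * Real.exp (-(κ * t / 4)))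
    (K : (Fin (d + 1) → ℤ) → ℂ) {M : ℝ} (hK : ∀ y, ‖K y‖ ≤ M * Real.exp (-(κ * supNorm y)))
    {N N' : Fin (d + 1) → ℕ} {t : ℕ} (ht1 : 1 ≤ t) (ht : ∀ i, t ≤ N i) (ht' : ∀ i, t ≤ N' i)
    (x : Fin (d + 1) → ℤ) (hx : ∀ i, 2 * |x i| ≤ N i) (hx' : ∀ i, 2 * |x i| ≤ N' i) :
    ‖(∑' m : Fin (d + 1) → ℤ, K (translate N x m)) - ∑' m : Fin (d + 1) → ℤ, K (translate N' x m)‖ ≤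
      2 * (M * C * Real.exp (-(κ * t / 4))) := by
  have h1 := (hC K M hK N t ht1 ht x hx).2
  have h2 := (hC K M hK N' t ht1 ht' x hx').2
  calc ‖(∑' m : Fin (d + 1) → ℤ, K (translate N x m)) - ∑' m : Fin (d + 1) → ℤ, K (translate N' x m)‖
      = ‖((∑' m : Fin (d + 1) → ℤ, K (translate N x m)) - K x) - ((∑' m : Fin (d + 1) → ℤ, K (translate N' x m)) - K x)‖ := by
        congr 1; abel
    _ ≤ ‖(∑' m : Fin (d + 1) → ℤ, K (translate N x m)) - K x‖ + ‖(∑' m : Fin (d + 1) → ℤ, K (translate N' x m)) - K x‖ := norm_sub_le _ _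
    _ ≤ 2 * (M * C * Real.exp (-(κ * t / 4))) := by linarith

/-- **LIMIT EXTRACTION (the infinite-volume bound from volume-uniform torus bounds)**: if for every `t` there is a period vector `N ≥ t + 1` centring `x` with `‖P_N K (x)‖ ≤ B`,
then `‖K(x)‖ ≤ B` — the tails vanish as `t → ∞`. [cite: Balaban1984PropagatorsI, p.36 ll.20–23 (ours)] [folklore] -/
theorem norm_le_of_forall_periodise_le {κ : ℝ} (hκ : 0 < κ) {C : ℝ}
    (hC : ∀ (K : (Fin (d + 1) → ℤ) → ℂ) (M : ℝ), (∀ y, ‖K y‖ ≤ M * Real.exp (-(κ * supNorm y))) →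
      ∀ (N : Fin (d + 1) → ℕ) (t : ℕ), 1 ≤ t → (∀ i, t ≤ N i) → ∀ x : Fin (d + 1) → ℤ, (∀ i, 2 * |x i| ≤ N i) →
        Summable (fun m : Fin (d + 1) → ℤ => K (translate N x m)) ∧
        ‖(∑' m : Fin (d + 1) → ℤ, K (translate N x m)) - K x‖ ≤ M * C * Real.exp (-(κ * t / 4)))
    (K : (Fin (d + 1) → ℤ) → ℂ) {M : ℝ} (hK : ∀ y, ‖K y‖ ≤ M * Real.exp (-(κ * supNorm y))) (x : Fin (d + 1) → ℤ) {B : ℝ}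
    (h : ∀ t : ℕ, ∃ N : Fin (d + 1) → ℕ, (∀ i, t + 1 ≤ N i) ∧ (∀ i, 2 * |x i| ≤ N i) ∧ ‖∑' m : Fin (d + 1) → ℤ, K (translate N x m)‖ ≤ B) :
    ‖K x‖ ≤ B := by
  have hM : 0 ≤ M := by
    have h := hK 0
    nlinarith [norm_nonneg (K 0), Real.exp_pos (-(κ * supNorm (0 : Fin (d + 1) → ℤ)))]
  -- `‖K x‖ ≤ B + M·C·e^{−κ(t+1)/4}` for every `t`
  have hstep : ∀ t : ℕ, ‖K x‖ ≤ B + M * C * Real.exp (-(κ * ((t + 1 : ℕ) : ℝ) / 4)) := by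
    intro t
    obtain ⟨N, hN, hx, hB⟩ := h t
    have htail := (hC K M hK N (t + 1) (by omega) hN x hx).2
    have := norm_sub_le (∑' m : Fin (d + 1) → ℤ, K (translate N x m)) ((∑' m : Fin (d + 1) → ℤ, K (translate N x m)) - K x)
    rw [sub_sub_cancel] at this
    linarith
  -- the tails tend to `0`
  have hlim : Tendsto (fun t : ℕ => B + M * C * Real.exp (-(κ * ((t + 1 : ℕ) : ℝ) / 4))) atTop (𝓝 (B + M * C * 0)) := by
    refine tendsto_const_nhds.add (tendsto_const_nhds.mul ?_)
    have h1 : Tendsto (fun t : ℕ => -(κ * ((t + 1 : ℕ) : ℝ) / 4)) atTop atBot := by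
      have h2 : Tendsto (fun t : ℕ => ((t + 1 : ℕ) : ℝ)) atTop atTop := by
        exact tendsto_natCast_atTop_atTop.comp (tendsto_add_atTop_nat 1)
      have h3 : Tendsto (fun t : ℕ => κ * ((t + 1 : ℕ) : ℝ) / 4) atTop atTop := by
        have : Tendsto (fun t : ℕ => ((t + 1 : ℕ) : ℝ) * (κ / 4)) atTop atTop := h2.atTop_mul_const (by positivity)
        refine this.congr fun t => ?_; ring
      exact tendsto_neg_atTop_atBot.comp h3
    exact Real.tendsto_exp_atBot.comp h1
  rw [mul_zero, add_zero] at hlim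
  exact le_of_tendsto_of_tendsto' tendsto_const_nhds hlim hstep

/-! ## §3  Real parts -/

/-- Real parts commute with periodisation: `Σ_m Re K(x + N·m) = Re Σ_m K(x + N·m)` (as complex numbers), for a summable family. [folklore] -/
theorem periodise_re {K : (Fin (d + 1) → ℤ) → ℂ} {N : Fin (d + 1) → ℕ} {x : Fin (d + 1) → ℤ}
    (hs : Summable (fun m : Fin (d + 1) → ℤ => K (translate N x m))) :
    ∑' m : Fin (d + 1) → ℤ, (((K (translate N x m)).re : ℝ) : ℂ) = (((∑' m : Fin (d + 1) → ℤ, K (translate N x m)).re : ℝ) : ℂ) := by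
  rw [← Complex.ofReal_tsum, Complex.re_tsum hs]

/-- The real-part kernel inherits the decay bound. [folklore] -/
theorem norm_re_le_of_norm_le {K : (Fin (d + 1) → ℤ) → ℂ} {κ M : ℝ} (hK : ∀ y, ‖K y‖ ≤ M * Real.exp (-(κ * supNorm y))) (y : Fin (d + 1) → ℤ) :
    ‖(((K y).re : ℝ) : ℂ)‖ ≤ M * Real.exp (-(κ * supNorm y)) :=
  (by rw [Complex.norm_real, Real.norm_eq_abs]; exact Complex.abs_re_le_norm _ : ‖(((K y).re : ℝ) : ℂ)‖ ≤ ‖K y‖).trans (hK y)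

end Summit.QuantumFields.YangMills.Theorems.PortU8.Images

end
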